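import Literature.MathematicalPhysics.QuantumFieldTheory.Balaban1983to89.B12Eq15QuadraticForm
import Literature.MathematicalPhysics.QuantumFieldTheory.Balaban1983to89.B12Lineariz267

/-!
# `Balaban1983to89.B12Eq210Scaling` — T. Bałaban, *Renormalization group approach to lattice gauge field
theories. I*, Commun. Math. Phys. **109** (1987) 249–301 [Balaban1987RG1]: the exponent of (2.10) p. 267 TYPED WITH
BODY ((2.5), (2.8) substituted) and the `g_k`-order bookkeeping of p. 267 leading to (2.11) PROVED

HONEST FRAMING (cell `lit-balaban`, verbatim): statement-level skeleton of published theorems with citation tags; proofs where landed; nothing here is a claim about the Yang–Mills mass gap.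

PDF held: `paper:balaban1987-cmp109-rg-i-small-field` (journal page = PDF page + 248); read from the page renders
`b2b-balaban-ref1/pages/1987-cmp109-rg-I-small-field/…-p018-x2.png` (p. 266) and `…-p019-x2.png` (p. 267).
SKELETON rows `B12.Eq2.10`, `B12.Eq2.11` (both absent before this file; 224 dependants each in DEPGRAPH v3).
Companion of `B12Eq15QuadraticForm` (the (1.5) data `Data`, `eq211_quadratic_form`) and of `B12Lineariz267` (the
linearising change of variables `B′ = B − hD̃(B)` of p. 267), both imported and used BY NAME, not re-declared.

THE PRINT, verbatim.  p. 266: *«G(B′) = Σ_{y∈T^{(k+1)}} Σ_{x∈B(y),x≠y} ½|B̃′(y,x)|² + G₃(B′) = ½G^{(2)}(B′) + G₃(B′). (2.5)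
The function G₃(B′) is an analytic function of B′, with an expansion beginning with third order terms»*;
*«Denoting terms of at least third order in H₁B′ by V(H₁B′) we get
A(U_k(V′V^{(k)})) = A(U_{k+1}) + ⟨H₁B′, J⟩ + ½⟨H₁B′, Δ₁H₁B′⟩ + V(H₁B′). (2.8)»*  p. 267: *«Let us write the integral
we obtain from (2.1) by the above described transformation
(2.1) = log N′_k⁻¹ ∫dB′ σ(B′) δ(Q̃(B′)) χ_k exp[−(1/g_k²)G(B′) − (1/g_k²)A(U_{k+1}) − (1/g_k²)⟨H₁B′, J⟩
− (1/2g_k²)⟨H₁B′, Δ₁H₁B′⟩ − (1/g_k²)V(H₁B′) + E_k(U_k(exp iB′V^{(k)}))], (2.10)»*; *«We are looking for an analytic,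
𝔤-valued function D̃(B′) … such that the transformation B′ = B − hD̃(B) linearizes the function Q̃(B′). … there exists
exactly one solution of this equation … D̃(B) has an expansion beginning with quadratic terms, and D̃^{(2)}(B) =
C̃^{(2)}(B). The above change of variables yields the integral with the δ-function δ(Q̃B). Next we make the scaling
transformation B = g_kB′. In the expression under the exponential the third, linear term in (2.10) vanishes now,
−(1/g_k)⟨H₁B′, J⟩ = 0 because ⟨δA′, J⟩ = 0 for all δA′ satisfying the condition Q̃Q_kδA′ = 0, and H₁B′ satisfies it.
Hence the only term with a negative power of g_k is the action evaluated at the configuration U_{k+1}. Terms of the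
order 0 in g_k are  ⟨H₁hC̃^{(2)}(B′), J⟩ − ½G^{(2)}(B′) − ½⟨H₁B′, Δ₁H₁B′⟩. (2.11)  The quadratic form in B′ above is
equal to −1/2⟨B′, Δ^{(k)}B′⟩»*.

WHAT THIS MODULE TYPES AND PROVES (over a field `𝕜`; `V` = the `B′`-fields, `W` = fine-lattice fields, `X` = functions
on the bonds of `T^{(k+1)}`, as in `B12Eq15QuadraticForm.Data` with `j = k`, `H = H₁ = H_{1,k}(U_k)`).
* `Setting` — the data entering the bracket of (2.10): the (1.5) data `D`, the number `A = A(U_{k+1})`, the functions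
  `G₃` of (2.5), `V` of (2.8) (`Vpot`), the term `B′ ↦ E_k(U_k(exp iB′V^{(k)}))` (`Ek`, carried verbatim, not expanded —
  its expansion is (2.12) ff.), and `D̃` of p. 267 (`Dt`).  `Gfix` = (2.5), `action28` = (2.8), **`bracket210`** = the
  bracket of (2.10) verbatim; `bracket210_eq` regroups it as `−g_k^{−2}[G(B′) + A(U_k(V′V^{(k)}))] + E_k`.
* `oldVar g B′ = gB′ − hD̃(gB′)` — the point at which the bracket is evaluated after `B′ = B − hD̃(B)` and `B = g_kB′`;
  `constraint_oldVar` — *«the above change of variables yields … δ(Q̃B)»*: `LQ̃(oldVar) + C̃(oldVar) = g·LQ̃B′`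
  (by `B12Lineariz267.linearizes`).
* **`bracket210_scaling`** (PROVED) — the bookkeeping as an EXACT identity: if `D̃(gB) = g²C̃^{(2)}(B) + g³R_D(B)`,
  `G₃(gY) = g³R_G(Y)`, `V(gA′) = g³R_V(A′)` (the printed "expansion beginning with quadratic / third order terms", in
  factorised form at the fixed `g = g_k ≠ 0`), then
  `bracket210 g (oldVar g B′) = −g^{−2}A − g^{−1}⟨H₁B′,J⟩ + terms211 B′ + g·rest + E_k(oldVar g B′)`
  with `terms211` = the display (2.11) and `rest` an explicit polynomial expression (`rest`).
* **`linear_term_vanishes`** (PROVED) — *«⟨H₁B′,J⟩ = 0 because ⟨δA′,J⟩ = 0 for all δA′ satisfying Q̃Q_kδA′ = 0, and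
  H₁B′ satisfies it»*: from `Q_kH₁ = 1` ([13] = [Balaban1985BackgroundPropagators] (3.126)/(3.129): `H = GQ*(QGQ*)⁻¹`)
  and the linearised constraint `Q̃B′ = 0`.
* **`bracket210_onConstraint`** (PROVED) — *«Hence the only term with a negative power of g_k is the action evaluated
  at the configuration U_{k+1}. Terms of the order 0 in g_k are (2.11)»*.
* `terms211_eq_neg_half_quad` — *«The quadratic form in B′ above is equal to −1/2⟨B′, Δ^{(k)}B′⟩»*
  (`B12Eq15QuadraticForm.eq211_quadratic_form`, by name).
NOT TYPED HERE (and not claimed): the constrained integral `log N′_k⁻¹∫dB′σ(B′)δ(Q̃(B′))χ_k exp[…]` of (2.10) as a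
measure-theoretic object (no carrier for the nonlinear δ-function in the tree; after linearisation and scaling the
Gaussian part is `B12Eq15QuadraticForm.Z14`); the analyticity statements; the expansion of the `E_k`-term ((2.12) ff.).
No `Prop` placeholder, no new fact; axioms standard.  Unit `lit-balaban-p07` (Phase-2 seat p07; G.5-34(d)), HOME
`run/shared/lean/pub/lit-balaban/`.
-/

namespace Literature.MathematicalPhysics.QuantumFieldTheory.Balaban1983to89.B12Eq210Scaling

open B12Eq15QuadraticForm

section Bracket

variable {𝕜 : Type*} [Field 𝕜] {V W X : Type*} [AddCommGroup V] [Module 𝕜 V] [AddCommGroup W]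
  [Module 𝕜 W] [AddCommGroup X] [Module 𝕜 X]

/-- **(2.11)**, the display: `⟨H₁hC̃^{(2)}(B′), J⟩ − ½G^{(2)}(B′) − ½⟨H₁B′, Δ₁H₁B′⟩`, for the (1.5) data `D` at `j = k`.
[cite: Balaban1987RG1, (2.11) p.267] -/
def terms211 (D : Data 𝕜 V W X) (B' : V) : 𝕜 :=
  D.pairJ (D.H (D.hop (D.Ctwo B'))) - (1 / 2 : 𝕜) * D.Gtwo B' - (1 / 2 : 𝕜) * D.Δ₁ (D.H B') (D.H B')

/-- *«The quadratic form in B′ above is equal to −1/2⟨B′, Δ^{(k)}B′⟩»* — `B12Eq15QuadraticForm.eq211_quadratic_form`.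
[cite: Balaban1987RG1, (2.11) p.267] -/
theorem terms211_eq_neg_half_quad [CharZero 𝕜] (D : Data 𝕜 V W X) (B' : V) :
    terms211 D B' = -(1 / 2 : 𝕜) * D.quad B' :=
  eq211_quadratic_form D B'

/-- The data entering the bracket of (2.10): the (1.5) data at `j = k` (`H₁ = H_{1,k}(U_k)`, `Δ₁`, `h`, `C̃^{(2)}`,
`⟨·, J⟩`, `G^{(2)}`), `A = A(U_{k+1})`, `G₃` of (2.5), `V` of (2.8), the `E_k`-term as a function of `B′`, and `D̃`.
[cite: Balaban1987RG1, (2.10) p.267] -/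
structure Setting (𝕜 : Type*) [Field 𝕜] (V W X : Type*) [AddCommGroup V] [Module 𝕜 V] [AddCommGroup W]
    [Module 𝕜 W] [AddCommGroup X] [Module 𝕜 X] where
  /-- the (1.5) data at `j = k`. -/
  D : Data 𝕜 V W X
  /-- `A(U_{k+1})`, the action at the background configuration. -/
  A : 𝕜
  /-- `G₃` of (2.5): *«an analytic function of B′, with an expansion beginning with third order terms»*. -/
  G₃ : V → 𝕜
  /-- `V` of (2.8): *«terms of at least third order in H₁B′»*. -/
  Vpot : W → 𝕜
  /-- `B′ ↦ E_k(U_k(exp iB′V^{(k)}))`, carried verbatim. -/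
  Ek : V → 𝕜
  /-- `D̃` of p. 267 (`B′ = B − hD̃(B)` linearizes `Q̃`). -/
  Dt : V → X

namespace Setting

variable (S : Setting 𝕜 V W X)

/-- **(2.5)**: `G(B′) = ½G^{(2)}(B′) + G₃(B′)`. [cite: Balaban1987RG1, (2.5) p.266] -/
def Gfix (B : V) : 𝕜 := (1 / 2 : 𝕜) * S.D.Gtwo B + S.G₃ B

/-- **(2.8)**: `A(U_k(V′V^{(k)})) = A(U_{k+1}) + ⟨H₁B′, J⟩ + ½⟨H₁B′, Δ₁H₁B′⟩ + V(H₁B′)`.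
[cite: Balaban1987RG1, (2.8) p.266] -/
def action28 (B : V) : 𝕜 :=
  S.A + S.D.pairJ (S.D.H B) + (1 / 2 : 𝕜) * S.D.Δ₁ (S.D.H B) (S.D.H B) + S.Vpot (S.D.H B)

/-- **The bracket of (2.10)**, verbatim: `−(1/g²)G(B′) − (1/g²)A(U_{k+1}) − (1/g²)⟨H₁B′, J⟩ − (1/2g²)⟨H₁B′, Δ₁H₁B′⟩
− (1/g²)V(H₁B′) + E_k(U_k(exp iB′V^{(k)}))`. [cite: Balaban1987RG1, (2.10) p.267] -/
def bracket210 (g : 𝕜) (B : V) : 𝕜 :=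
  -(1 / g ^ 2) * S.Gfix B - (1 / g ^ 2) * S.A - (1 / g ^ 2) * S.D.pairJ (S.D.H B)
    - (1 / (2 * g ^ 2)) * S.D.Δ₁ (S.D.H B) (S.D.H B) - (1 / g ^ 2) * S.Vpot (S.D.H B) + S.Ek B

/-- The bracket of (2.10) is `−g^{−2}[G(B′) + A(U_k(V′V^{(k)}))] + E_k(…)` with (2.5), (2.8) — i.e. it IS the exponent of
(2.1) written in the variables `B′`. [cite: Balaban1987RG1, (2.10) p.267] -/
theorem bracket210_eq (g : 𝕜) (B : V) :
    S.bracket210 g B = -(1 / g ^ 2) * (S.Gfix B + S.action28 B) + S.Ek B := by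
  simp only [bracket210, action28]
  ring

/-- The point at which the bracket of (2.10) is evaluated after the change of variables `B′ = B − hD̃(B)` and the
scaling `B = g_kB′`: `gB′ − hD̃(gB′)`. [cite: Balaban1987RG1, (2.11) p.267] -/
def oldVar (g : 𝕜) (B' : V) : V := g • B' - S.D.hop (S.Dt (g • B'))

/-- *«The above change of variables yields the integral with the δ-function δ(Q̃B)»* and *«B = g_kB′»*: at the point
`oldVar g B′` the constraint function `LQ̃(·) + C̃(·)` equals `g·LQ̃B′` — by `B12Lineariz267.linearizes`, given
`LQ̃h = 1` and the defining fixed-point equation of `D̃`. [cite: Balaban1987RG1, (2.11) p.267] -/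
theorem constraint_oldVar (LQ : V →ₗ[𝕜] X) (Ct : V → X) (hLQh : ∀ D' : X, LQ (S.D.hop D') = D')
    (hfix : ∀ B : V, Ct (B - S.D.hop (S.Dt B)) = S.Dt B) (g : 𝕜) (B' : V) :
    LQ (S.oldVar g B') + Ct (S.oldVar g B') = g • LQ B' := by
  rw [oldVar, B12Lineariz267.linearizes hLQh (hfix (g • B')), map_smul]

/-- The correction `Y` with `hD̃(gB′) = g²Y`: `Y = hC̃^{(2)}(B′) + g·hR_D(B′)`. [cite: Balaban1987RG1, (2.11) p.267] -/
def Ycorr (g : 𝕜) (RD : V → X) (B' : V) : V := S.D.hop (S.D.Ctwo B') + g • S.D.hop (RD B')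

/-- `Z = B′ − gY`, so that `gB′ − hD̃(gB′) = gZ`. [cite: Balaban1987RG1, (2.11) p.267] -/
def Zvar (g : 𝕜) (RD : V → X) (B' : V) : V := B' - g • S.Ycorr g RD B'

/-- The explicit coefficient of `g` in the bookkeeping identity `bracket210_scaling` (all the terms of positive order
in `g_k` other than the `E_k`-term). [cite: Balaban1987RG1, (2.11) p.267] -/
def rest (g : 𝕜) (RD : V → X) (RG : V → 𝕜) (RV : W → 𝕜) (B' : V) : 𝕜 :=
  S.D.pairJ (S.D.H (S.D.hop (RD B')))
    + (1 / 2 : 𝕜) * (S.D.G₂ B' (S.Ycorr g RD B') + S.D.G₂ (S.Ycorr g RD B') B')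
    - g * ((1 / 2 : 𝕜) * S.D.Gtwo (S.Ycorr g RD B'))
    - RG (S.Zvar g RD B')
    + (1 / 2 : 𝕜) * (S.D.Δ₁ (S.D.H B') (S.D.H (S.Ycorr g RD B')) + S.D.Δ₁ (S.D.H (S.Ycorr g RD B')) (S.D.H B'))
    - g * ((1 / 2 : 𝕜) * S.D.Δ₁ (S.D.H (S.Ycorr g RD B')) (S.D.H (S.Ycorr g RD B')))
    - RV (S.D.H (S.Zvar g RD B'))

/-- `gB′ − hD̃(gB′) = gZ`. [cite: Balaban1987RG1, (2.11) p.267] -/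
theorem oldVar_eq_smul_Zvar {g : 𝕜} (RD : V → X)
    (hDt : ∀ B : V, S.Dt (g • B) = g ^ 2 • S.D.Ctwo B + g ^ 3 • RD B) (B' : V) :
    S.oldVar g B' = g • S.Zvar g RD B' := by
  simp only [oldVar, Zvar, Ycorr, hDt, map_add, map_smul]
  module

/-- **The `g_k`-order bookkeeping of p. 267, as an exact identity.**  After `B′ = B − hD̃(B)` (with
`D̃ = C̃^{(2)} + (third order)`: `D̃(gB) = g²C̃^{(2)}(B) + g³R_D(B)`) and `B = g_kB′`, the bracket of (2.10) is
`−g_k^{−2}A(U_{k+1}) − g_k^{−1}⟨H₁B′, J⟩ + [⟨H₁hC̃^{(2)}(B′), J⟩ − ½G^{(2)}(B′) − ½⟨H₁B′, Δ₁H₁B′⟩] + g_k·rest + E_k(…)`,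
using `G₃(gY) = g³R_G(Y)` ((2.5): third order) and `V(gA′) = g³R_V(A′)` ((2.8): third order).
[cite: Balaban1987RG1, (2.10)-(2.11) p.267] -/
theorem bracket210_scaling {g : 𝕜} (hg : g ≠ 0) (RD : V → X) (RG : V → 𝕜) (RV : W → 𝕜)
    (hDt : ∀ B : V, S.Dt (g • B) = g ^ 2 • S.D.Ctwo B + g ^ 3 • RD B)
    (hG₃ : ∀ Y : V, S.G₃ (g • Y) = g ^ 3 * RG Y) (hV : ∀ A' : W, S.Vpot (g • A') = g ^ 3 * RV A') (B' : V) :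
    S.bracket210 g (S.oldVar g B') =
      -(1 / g ^ 2) * S.A - (1 / g) * S.D.pairJ (S.D.H B') + terms211 S.D B' + g * S.rest g RD RG RV B'
        + S.Ek (S.oldVar g B') := by
  rw [S.oldVar_eq_smul_Zvar RD hDt B']
  have h1 : S.G₃ (g • S.Zvar g RD B') = g ^ 3 * RG (S.Zvar g RD B') := hG₃ _
  have h2 : S.Vpot (S.D.H (g • S.Zvar g RD B')) = g ^ 3 * RV (S.D.H (S.Zvar g RD B')) := by
    rw [map_smul, hV]
  have h3 : S.D.Gtwo (g • S.Zvar g RD B') = g ^ 2 * S.D.Gtwo (S.Zvar g RD B') := by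
    simp only [Data.Gtwo, map_smul, LinearMap.smul_apply, smul_eq_mul]
    ring
  have h4 : S.D.pairJ (S.D.H (g • S.Zvar g RD B')) = g * S.D.pairJ (S.D.H (S.Zvar g RD B')) := by
    rw [map_smul, map_smul, smul_eq_mul]
  have h5 : S.D.Δ₁ (S.D.H (g • S.Zvar g RD B')) (S.D.H (g • S.Zvar g RD B'))
      = g ^ 2 * S.D.Δ₁ (S.D.H (S.Zvar g RD B')) (S.D.H (S.Zvar g RD B')) := by
    simp only [map_smul, LinearMap.smul_apply, smul_eq_mul]
    ring
  simp only [bracket210, Gfix, h1, h2, h3, h4, h5]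
  have hHZ : S.D.H (S.Zvar g RD B') = S.D.H B' - g • S.D.H (S.Ycorr g RD B') := by
    rw [Zvar, map_sub, map_smul]
  have hGZ : S.D.Gtwo (S.Zvar g RD B')
      = S.D.Gtwo B' - g * (S.D.G₂ B' (S.Ycorr g RD B') + S.D.G₂ (S.Ycorr g RD B') B')
        + g ^ 2 * S.D.Gtwo (S.Ycorr g RD B') := by
    simp only [Data.Gtwo, Zvar, map_sub, map_smul, LinearMap.sub_apply, LinearMap.smul_apply, smul_eq_mul]
    ring
  have hJZ : S.D.pairJ (S.D.H (S.Zvar g RD B'))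
      = S.D.pairJ (S.D.H B') - g * (S.D.pairJ (S.D.H (S.D.hop (S.D.Ctwo B')))
        + g * S.D.pairJ (S.D.H (S.D.hop (RD B')))) := by
    rw [hHZ, Ycorr]
    simp only [map_sub, map_smul, map_add, smul_eq_mul]
  have hΔZ : S.D.Δ₁ (S.D.H (S.Zvar g RD B')) (S.D.H (S.Zvar g RD B'))
      = S.D.Δ₁ (S.D.H B') (S.D.H B')
        - g * (S.D.Δ₁ (S.D.H B') (S.D.H (S.Ycorr g RD B')) + S.D.Δ₁ (S.D.H (S.Ycorr g RD B')) (S.D.H B'))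
        + g ^ 2 * S.D.Δ₁ (S.D.H (S.Ycorr g RD B')) (S.D.H (S.Ycorr g RD B')) := by
    rw [hHZ]
    simp only [map_sub, map_smul, LinearMap.sub_apply, LinearMap.smul_apply, smul_eq_mul]
    ring
  rw [hGZ, hJZ, hΔZ, terms211, rest]
  field_simp
  ring

/-- *«−(1/g_k)⟨H₁B′, J⟩ = 0 because ⟨δA′, J⟩ = 0 for all δA′ satisfying the condition Q̃Q_kδA′ = 0, and H₁B′ satisfies
it»*: with `Q_kH₁ = 1` ([13] (3.126): `H = GQ*(QGQ*)⁻¹`) and the linearised constraint `Q̃B′ = 0` (the δ-function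
`δ(Q̃B)`, `B = g_kB′`), `Q̃Q_k(H₁B′) = Q̃B′ = 0`. [cite: Balaban1987RG1, (2.11) p.267] -/
theorem linear_term_vanishes (D : Data 𝕜 V W X) (LQ : V →ₗ[𝕜] X) (Qk : W →ₗ[𝕜] V)
    (hQH : ∀ B : V, Qk (D.H B) = B) (hJ : ∀ a : W, LQ (Qk a) = 0 → D.pairJ a = 0) {B' : V} (hB' : LQ B' = 0) :
    D.pairJ (D.H B') = 0 :=
  hJ _ (by rw [hQH]; exact hB')

/-- **p. 267, conclusion**: on the constraint surface `Q̃B′ = 0` the bracket of (2.10), after `B′ = B − hD̃(B)` and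
`B = g_kB′`, is `−g_k^{−2}A(U_{k+1}) + (2.11) + g_k·rest + E_k(…)` — *«the only term with a negative power of g_k is
the action evaluated at the configuration U_{k+1}. Terms of the order 0 in g_k are (2.11)»*.
[cite: Balaban1987RG1, (2.10)-(2.11) p.267] -/
theorem bracket210_onConstraint {g : 𝕜} (hg : g ≠ 0) (RD : V → X) (RG : V → 𝕜) (RV : W → 𝕜)
    (hDt : ∀ B : V, S.Dt (g • B) = g ^ 2 • S.D.Ctwo B + g ^ 3 • RD B)
    (hG₃ : ∀ Y : V, S.G₃ (g • Y) = g ^ 3 * RG Y) (hV : ∀ A' : W, S.Vpot (g • A') = g ^ 3 * RV A')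
    (LQ : V →ₗ[𝕜] X) (Qk : W →ₗ[𝕜] V) (hQH : ∀ B : V, Qk (S.D.H B) = B)
    (hJ : ∀ a : W, LQ (Qk a) = 0 → S.D.pairJ a = 0) {B' : V} (hB' : LQ B' = 0) :
    S.bracket210 g (S.oldVar g B') =
      -(1 / g ^ 2) * S.A + terms211 S.D B' + g * S.rest g RD RG RV B' + S.Ek (S.oldVar g B') := by
  rw [S.bracket210_scaling hg RD RG RV hDt hG₃ hV B', linear_term_vanishes S.D LQ Qk hQH hJ hB']
  ring

/-- The same conclusion with (2.11) replaced by `−½⟨B′, Δ^{(k)}B′⟩` (characteristic zero): the order-0 part is the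
Gaussian exponent of (1.4) at `j = k`. [cite: Balaban1987RG1, (2.11) p.267] -/
theorem bracket210_onConstraint_quad [CharZero 𝕜] {g : 𝕜} (hg : g ≠ 0) (RD : V → X) (RG : V → 𝕜)
    (RV : W → 𝕜) (hDt : ∀ B : V, S.Dt (g • B) = g ^ 2 • S.D.Ctwo B + g ^ 3 • RD B)
    (hG₃ : ∀ Y : V, S.G₃ (g • Y) = g ^ 3 * RG Y) (hV : ∀ A' : W, S.Vpot (g • A') = g ^ 3 * RV A')
    (LQ : V →ₗ[𝕜] X) (Qk : W →ₗ[𝕜] V) (hQH : ∀ B : V, Qk (S.D.H B) = B)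
    (hJ : ∀ a : W, LQ (Qk a) = 0 → S.D.pairJ a = 0) {B' : V} (hB' : LQ B' = 0) :
    S.bracket210 g (S.oldVar g B') =
      -(1 / g ^ 2) * S.A - (1 / 2 : 𝕜) * S.D.quad B' + g * S.rest g RD RG RV B' + S.Ek (S.oldVar g B') := by
  rw [S.bracket210_onConstraint hg RD RG RV hDt hG₃ hV LQ Qk hQH hJ hB', terms211_eq_neg_half_quad]
  ring

end Setting

end Bracket

end Literature.MathematicalPhysics.QuantumFieldTheory.Balaban1983to89.B12Eq210Scaling
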